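import Summits.QuantumFields.YangMills.Theorems.F4SubCurvatureDoorShortRootRigidityPlanarFrameTimeHolomorphy
import Literature.Analysis.Complex.CrossTheoremNStrips
import Mathlib
import HarnessLib

/-!
# The three RP frames of the hexagonal planar class and the two-frame holomorphic chart

Helper (definition-free) for the by-name rungs R1 `PlanarAnalyticOffZero` / R1⁺ `PlanarConicChart` of LINE g20-A «angular type»
(`Cruxes/ShortRootRigidity/Lines/angular_type_rungs.lean`, crux ⟨stmt-QuantumFields-23035⟩), for `k ∈ InPlanarClass`:
`rotPos_invariant`/`rotNeg_invariant` (the `D₆` rotations `rot(±π/3) = -(θ₂∘σ_{n'})`, `-(σ_{n'}∘θ₂)`); `frameHolomorphy_zero/_pos/_neg`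
(R0 `planarFrameTimeHolomorphy` transported to the frames `n± = (1/2, ±√3/2)`: at `q` with frame time `s ≠ 0`, `u ↦ k(q + un)` continues to
`|w| < |s|` with the axis bound `k((s + Re w)e₀)`); `exists_good_pair` (THE 60° GEOMETRY: two of the three frame times `y₀`, `y₀/2 ± (√3/2)y₁`
are `≥ ‖y‖/2` in absolute value, as `a = b + c`, `a² + b² + c² = (3/2)‖y‖²`); `frame_slice` / `exists_frameChart` (with `L = ‖y‖/6` the slices
of `t ↦ k(y + Lt₁n₁ + Lt₂n₂)` on the unit cube are traces of unit-disc holomorphic functions bounded by the maximum of `|k|` on the annulus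
`‖y‖/4 ≤ ‖·‖ ≤ 2‖y‖`; the two-variable cross theorem with estimate — consumed as a hypothesis for its universal radius — gives ONE holomorphic
chart with the SHARP bound: the common core of R1 and R1⁺).
HONEST LABEL: bookkeeping; nothing about ⟨23035⟩, R2d or any summit is proved by this file.
-/

noncomputable section

open MeasureTheory Filter Topology Set Metric
open scoped BigOperators

namespace Summit.QuantumFields.YangMills.Theorems.F4SubCurvatureDoorPlanarFrames

open Literature.MathematicalPhysics.QuantumLattice (timeReflection timeReflection_apply)
open Summit.QuantumFields.YangMills.Theorems.F4SubCurvatureDoorSliceDensityRegistered (E2)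
open Summit.QuantumFields.YangMills.Theorems.F4SubCurvatureDoorSliceInClassRegistered (hexReflection InPlanarClass)
open Summit.QuantumFields.YangMills.Theorems.F4SubCurvatureDoorPlanarLaplaceFourier
open Summit.QuantumFields.YangMills.Theorems.F4SubCurvatureDoorPlanarFrameTimeHolomorphyRegistered
  (mk2 PlanarFrameTimeHolomorphy planarFrameTimeHolomorphy)

/-- `mk2 a b` has first coordinate `a`. -/
theorem mk2_zero (a b : ℝ) : mk2 a b 0 = a := mk_apply_zero a b

/-- `mk2 a b` has second coordinate `b`. -/
theorem mk2_one (a b : ℝ) : mk2 a b 1 = b := mk_apply_one a b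

/-- `√3² = 3`. -/
theorem sqrt3_sq : Real.sqrt 3 ^ 2 = 3 := Real.sq_sqrt (by norm_num)

/-- `‖mk2 a b‖² = a² + b²`. -/
theorem norm_mk2_sq (a b : ℝ) : ‖mk2 a b‖ ^ 2 = a ^ 2 + b ^ 2 := by
  rw [EuclideanSpace.norm_eq, Real.sq_sqrt (Finset.sum_nonneg fun i _ => by positivity), Fin.sum_univ_two,
    mk2_zero, mk2_one, Real.norm_eq_abs, Real.norm_eq_abs, sq_abs, sq_abs]

/-- `‖y‖² = y₀² + y₁²`. -/
theorem norm_sq_eq (y : E2) : ‖y‖ ^ 2 = y 0 ^ 2 + y 1 ^ 2 := by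
  rw [← mk_eta y]
  exact norm_mk2_sq (y 0) (y 1)

/-- `‖mk2 a 0‖ = |a|`. -/
theorem norm_mk2_axis (a : ℝ) : ‖mk2 a 0‖ = |a| := by
  have h := norm_mk2_sq a 0
  rw [zero_pow two_ne_zero, add_zero] at h
  rw [← Real.sqrt_sq (norm_nonneg _), h, Real.sqrt_sq_eq_abs]

/-- Invariance under the rotation by `+π/3`: `k(y₀/2 - (√3/2)y₁, (√3/2)y₀ + y₁/2) = k(y)` (`rot(π/3) = -(θ₂ ∘ σ_{n'})`). -/
theorem rotPos_invariant {k : E2 → ℝ} (hk : InPlanarClass k) (y : E2) :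
    k (mk2 (y 0 / 2 - Real.sqrt 3 / 2 * y 1) (Real.sqrt 3 / 2 * y 0 + y 1 / 2)) = k y := by
  obtain ⟨-, -, hθ, hhex, hneg, -, -⟩ := hk
  have e : mk2 (y 0 / 2 - Real.sqrt 3 / 2 * y 1) (Real.sqrt 3 / 2 * y 0 + y 1 / 2)
      = -(timeReflection 2 (hexReflection y)) := by
    refine ext2 ?_ ?_
    · rw [mk2_zero]; simp [hexReflection, timeReflection_apply]
    · rw [mk2_one]; simp [hexReflection, timeReflection_apply]; ring
  rw [e, hneg, hθ, hhex]

/-- Invariance under the rotation by `-π/3`: `k(y₀/2 + (√3/2)y₁, -(√3/2)y₀ + y₁/2) = k(y)` (`rot(-π/3) = -(σ_{n'} ∘ θ₂)`). -/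
theorem rotNeg_invariant {k : E2 → ℝ} (hk : InPlanarClass k) (y : E2) :
    k (mk2 (y 0 / 2 + Real.sqrt 3 / 2 * y 1) (-(Real.sqrt 3 / 2 * y 0) + y 1 / 2)) = k y := by
  obtain ⟨-, -, hθ, hhex, hneg, -, -⟩ := hk
  have e : mk2 (y 0 / 2 + Real.sqrt 3 / 2 * y 1) (-(Real.sqrt 3 / 2 * y 0) + y 1 / 2)
      = -(hexReflection (timeReflection 2 y)) := by
    refine ext2 ?_ ?_
    · rw [mk2_zero]; simp [hexReflection, timeReflection_apply]; ring
    · rw [mk2_one]; simp [hexReflection, timeReflection_apply]; ring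
  rw [e, hneg, hhex, hθ]

/-- **Frame `e₀ = (1, 0)`** (R0 itself): at `q` with `q₀ ≠ 0`, `u ↦ k(q₀ + u, q₁)` continues to `|w| < |q₀|` with the axis bound. -/
theorem frameHolomorphy_zero {k : E2 → ℝ} (hk : InPlanarClass k) (q : E2) (hq : q 0 ≠ 0) :
    ∃ g : ℂ → ℂ, DifferentiableOn ℂ g (ball (0 : ℂ) |q 0|) ∧
      (∀ u : ℝ, |u| < |q 0| → g u = k (mk2 (q 0 + u * 1) (q 1 + u * 0))) ∧
      ∀ w ∈ ball (0 : ℂ) |q 0|, ‖g w‖ ≤ k (mk2 (q 0 + w.re) 0) := by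
  obtain ⟨g, hg, hreal, hbound⟩ := planarFrameTimeHolomorphy k hk q hq
  refine ⟨g, hg, fun u hu => ?_, hbound⟩
  rw [hreal u hu, mul_one, mul_zero, add_zero]

/-- **Frame `n₊ = (1/2, √3/2)`**: at `q` with `s = q₀/2 + (√3/2)q₁ ≠ 0`, `u ↦ k(q + u n₊)` continues to `|w| < |s|`, bounded by the
axis values `k((s + Re w) e₀)` (R0 at the rotated point `rot(-π/3) q`, plus `rotNeg_invariant`). -/
theorem frameHolomorphy_pos {k : E2 → ℝ} (hk : InPlanarClass k) (q : E2) (hq : q 0 / 2 + Real.sqrt 3 / 2 * q 1 ≠ 0) :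
    ∃ g : ℂ → ℂ, DifferentiableOn ℂ g (ball (0 : ℂ) |q 0 / 2 + Real.sqrt 3 / 2 * q 1|) ∧
      (∀ u : ℝ, |u| < |q 0 / 2 + Real.sqrt 3 / 2 * q 1| →
        g u = k (mk2 (q 0 + u * (1 / 2)) (q 1 + u * (Real.sqrt 3 / 2)))) ∧
      ∀ w ∈ ball (0 : ℂ) |q 0 / 2 + Real.sqrt 3 / 2 * q 1|, ‖g w‖ ≤ k (mk2 (q 0 / 2 + Real.sqrt 3 / 2 * q 1 + w.re) 0) := by
  set q' : E2 := mk2 (q 0 / 2 + Real.sqrt 3 / 2 * q 1) (-(Real.sqrt 3 / 2 * q 0) + q 1 / 2) with hq'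
  have hq'0 : q' 0 = q 0 / 2 + Real.sqrt 3 / 2 * q 1 := mk2_zero _ _
  have hq'1 : q' 1 = -(Real.sqrt 3 / 2 * q 0) + q 1 / 2 := mk2_one _ _
  obtain ⟨g, hg, hreal, hbound⟩ := planarFrameTimeHolomorphy k hk q' (by rw [hq'0]; exact hq)
  rw [hq'0] at hg hreal hbound
  refine ⟨g, hg, fun u hu => ?_, hbound⟩
  rw [hreal u hu, hq'1]
  set p : E2 := mk2 (q 0 + u * (1 / 2)) (q 1 + u * (Real.sqrt 3 / 2)) with hp
  have h := rotNeg_invariant hk p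
  rw [← h, hp, mk2_zero, mk2_one]
  refine congrArg (fun v : E2 => ((k v : ℝ) : ℂ)) (ext2 ?_ ?_)
  · rw [mk2_zero, mk2_zero]; ring_nf; rw [sqrt3_sq]; ring
  · rw [mk2_one, mk2_one]; ring_nf

/-- **Frame `n₋ = (1/2, -√3/2)`**: at `q` with `s = q₀/2 - (√3/2)q₁ ≠ 0`, `u ↦ k(q + u n₋)` continues to `|w| < |s|`, bounded by the
axis values `k((s + Re w) e₀)` (R0 at `rot(π/3) q`, plus `rotPos_invariant`). -/
theorem frameHolomorphy_neg {k : E2 → ℝ} (hk : InPlanarClass k) (q : E2) (hq : q 0 / 2 - Real.sqrt 3 / 2 * q 1 ≠ 0) :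
    ∃ g : ℂ → ℂ, DifferentiableOn ℂ g (ball (0 : ℂ) |q 0 / 2 - Real.sqrt 3 / 2 * q 1|) ∧
      (∀ u : ℝ, |u| < |q 0 / 2 - Real.sqrt 3 / 2 * q 1| →
        g u = k (mk2 (q 0 + u * (1 / 2)) (q 1 + u * (-(Real.sqrt 3 / 2))))) ∧
      ∀ w ∈ ball (0 : ℂ) |q 0 / 2 - Real.sqrt 3 / 2 * q 1|, ‖g w‖ ≤ k (mk2 (q 0 / 2 - Real.sqrt 3 / 2 * q 1 + w.re) 0) := by
  set q' : E2 := mk2 (q 0 / 2 - Real.sqrt 3 / 2 * q 1) (Real.sqrt 3 / 2 * q 0 + q 1 / 2) with hq'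
  have hq'0 : q' 0 = q 0 / 2 - Real.sqrt 3 / 2 * q 1 := mk2_zero _ _
  have hq'1 : q' 1 = Real.sqrt 3 / 2 * q 0 + q 1 / 2 := mk2_one _ _
  obtain ⟨g, hg, hreal, hbound⟩ := planarFrameTimeHolomorphy k hk q' (by rw [hq'0]; exact hq)
  rw [hq'0] at hg hreal hbound
  refine ⟨g, hg, fun u hu => ?_, hbound⟩
  rw [hreal u hu, hq'1]
  set p : E2 := mk2 (q 0 + u * (1 / 2)) (q 1 + u * (-(Real.sqrt 3 / 2))) with hp
  have h := rotPos_invariant hk p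
  rw [← h, hp, mk2_zero, mk2_one]
  refine congrArg (fun v : E2 => ((k v : ℝ) : ℂ)) (ext2 ?_ ?_)
  · rw [mk2_zero, mk2_zero]; ring_nf; rw [sqrt3_sq]; ring
  · rw [mk2_one, mk2_one]; ring_nf

/-- **Two of the three frame times are large.**  For `y ∈ ℝ²` the frame times `a = y₀`, `b = y₀/2 + (√3/2)y₁`,
`c = y₀/2 - (√3/2)y₁` satisfy `a = b + c` and `a² + b² + c² = (3/2)‖y‖²`; hence at least two of `|a|, |b|, |c|` are `≥ ‖y‖/2`. -/
theorem exists_good_pair (y : E2) :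
    (‖y‖ / 2 ≤ |y 0| ∧ ‖y‖ / 2 ≤ |y 0 / 2 + Real.sqrt 3 / 2 * y 1|) ∨
    (‖y‖ / 2 ≤ |y 0| ∧ ‖y‖ / 2 ≤ |y 0 / 2 - Real.sqrt 3 / 2 * y 1|) ∨
    (‖y‖ / 2 ≤ |y 0 / 2 + Real.sqrt 3 / 2 * y 1| ∧ ‖y‖ / 2 ≤ |y 0 / 2 - Real.sqrt 3 / 2 * y 1|) := by
  set a := y 0 with ha
  set b := y 0 / 2 + Real.sqrt 3 / 2 * y 1 with hb
  set c := y 0 / 2 - Real.sqrt 3 / 2 * y 1 with hc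
  have hn : 0 ≤ ‖y‖ := norm_nonneg y
  have hsum : a ^ 2 + b ^ 2 + c ^ 2 = 3 / 2 * ‖y‖ ^ 2 := by
    rw [norm_sq_eq, hb, hc]; ring_nf; rw [sqrt3_sq]; ring
  have habc : a = b + c := by rw [hb, hc]; ring
  have key : ∀ p q : ℝ, |p| < ‖y‖ / 2 → |q| < ‖y‖ / 2 →
      p ^ 2 + q ^ 2 + (p + q) ^ 2 < 3 / 2 * ‖y‖ ^ 2 ∧ p ^ 2 + q ^ 2 + (p - q) ^ 2 < 3 / 2 * ‖y‖ ^ 2 := by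
    intro p q hp hq
    rw [abs_lt] at hp hq
    constructor <;> nlinarith
  by_contra h
  simp only [not_or, not_and_or, not_le] at h
  obtain ⟨h1, h2, h3⟩ := h
  by_cases hA : |a| < ‖y‖ / 2
  · rcases h3 with hB | hC
    · have hk := (key a b hA hB).2
      have e : c = a - b := by linarith
      rw [e] at hsum
      linarith
    · have hk := (key a c hA hC).2
      have e : b = a - c := by linarith
      rw [e] at hsum
      linarith
  · have hB : |b| < ‖y‖ / 2 := h1.resolve_left hA
    have hC : |c| < ‖y‖ / 2 := h2.resolve_left hA
    have hk := (key b c hB hC).1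
    rw [habc] at hsum
    linarith

/-- Coordinates of a two-term linear combination. -/
theorem lincomb_apply (y u v : E2) (c d : ℝ) (i : Fin 2) : (y + c • u + d • v) i = y i + c * u i + d * v i := by
  simp

/-- A unit coordinate pair gives a unit vector: `‖mk2 a b‖ = 1` when `a² + b² = 1`. -/
theorem norm_mk2_eq_one {a b : ℝ} (h : a ^ 2 + b ^ 2 = 1) : ‖mk2 a b‖ = 1 := by
  have h1 : ‖mk2 a b‖ ^ 2 = 1 ^ 2 := by rw [norm_mk2_sq, one_pow, h]
  exact (pow_left_inj₀ (norm_nonneg _) zero_le_one two_ne_zero).1 h1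

/-- Cauchy–Schwarz for a unit frame: `|a q₀ + b q₁| ≤ ‖q‖` when `a² + b² = 1`. -/
theorem abs_frameTime_le_norm {a b : ℝ} (h : a ^ 2 + b ^ 2 = 1) (q : E2) : |a * q 0 + b * q 1| ≤ ‖q‖ := by
  have hsq : (a * q 0 + b * q 1) ^ 2 ≤ ‖q‖ ^ 2 := by
    rw [norm_sq_eq]
    nlinarith [sq_nonneg (a * q 1 - b * q 0)]
  exact abs_le_of_sq_le_sq' hsq (norm_nonneg _) |>.elim (fun h1 h2 => abs_le.2 ⟨h1, h2⟩)

/-- **One slice of the two-frame chart.**  With `L = ‖y‖/6`, a unit frame `(a, b)` with frame time `τ`, `|τ(y)| ≥ ‖y‖/2`, complex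
time translation along it (`hF`), and a second unit direction `n'` with `|⟪n, n'⟫| ≤ 1/2`: for `|d| < 1` the slice
`s ↦ k(y + sL·n + dL·n')` is on `(-1, 1)` the trace of a function holomorphic on the unit disc and bounded by any bound `M` of `k` on the
annulus `‖y‖/4 ≤ ‖·‖ ≤ 2‖y‖`. -/
theorem frame_slice {k : E2 → ℝ} {y : E2} {L M : ℝ} (hL : L = ‖y‖ / 6) (hLpos : 0 < L)
    (hMnn : ∀ z : E2, ‖y‖ / 4 ≤ ‖z‖ → ‖z‖ ≤ 2 * ‖y‖ → k z ≤ M)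
    (τ : E2 → ℝ) (a b : ℝ) (n n' : E2) (a' b' : ℝ) (hn0 : n 0 = a) (hn1 : n 1 = b) (hnorm' : ‖n'‖ = 1)
    (hn'0 : n' 0 = a') (hn'1 : n' 1 = b') (hab : a ^ 2 + b ^ 2 = 1) (hτ : ∀ q, τ q = a * q 0 + b * q 1)
    (hip : |a * a' + b * b'| ≤ 1 / 2) (hyτ : ‖y‖ / 2 ≤ |τ y|)
    (hF : ∀ q : E2, τ q ≠ 0 → ∃ g : ℂ → ℂ, DifferentiableOn ℂ g (ball (0 : ℂ) |τ q|) ∧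
        (∀ u : ℝ, |u| < |τ q| → g u = k (mk2 (q 0 + u * a) (q 1 + u * b))) ∧
        ∀ w ∈ ball (0 : ℂ) |τ q|, ‖g w‖ ≤ k (mk2 (τ q + w.re) 0))
    (d : ℝ) (hd : |d| < 1) :
    ∃ g : ℂ → ℂ, DifferentiableOn ℂ g (ball (0 : ℂ) 1) ∧ (∀ w ∈ ball (0 : ℂ) 1, ‖g w‖ ≤ M) ∧
      ∀ s : ℝ, |s| < 1 → g s = ((k (y + (s * L) • n + (d * L) • n') : ℝ) : ℂ) := by
  obtain ⟨q, hq⟩ : ∃ q : E2, q = y + (d * L) • n' := ⟨_, rfl⟩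
  have hq0 : q 0 = y 0 + d * L * a' := by rw [hq]; simp [hn'0]
  have hq1 : q 1 = y 1 + d * L * b' := by rw [hq]; simp [hn'1]
  obtain ⟨σ, hσdef⟩ : ∃ σ : ℝ, σ = τ q := ⟨_, rfl⟩
  have hτq : σ = τ y + d * L * (a * a' + b * b') := by rw [hσdef, hτ q, hτ y, hq0, hq1]; ring
  have hdL : |d * L| ≤ L := by
    rw [abs_mul, abs_of_pos hLpos]
    exact le_of_lt (mul_lt_of_lt_one_left hLpos hd)
  have hyL : ‖y‖ = 6 * L := by rw [hL]; ring
  have hσ : 5 * L / 2 ≤ |σ| := by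
    have h1 : |d * L * (a * a' + b * b')| ≤ L * (1 / 2) := by
      rw [abs_mul]; exact mul_le_mul hdL hip (abs_nonneg _) hLpos.le
    have h2 : |τ y| - |d * L * (a * a' + b * b')| ≤ |τ y + d * L * (a * a' + b * b')| := by
      have := abs_sub_abs_le_abs_sub (τ y) (-(d * L * (a * a' + b * b')))
      rwa [sub_neg_eq_add, abs_neg] at this
    rw [hτq]
    rw [hyL] at hyτ
    linarith
  have hσL : L < |σ| := by linarith
  have hσ_ne : τ q ≠ 0 := fun h => by rw [← hσdef] at h; rw [h, abs_zero] at hσL; linarith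
  obtain ⟨g₁, hg₁, hreal₁, hbd₁⟩ := hF q hσ_ne
  rw [← hσdef] at hg₁ hreal₁ hbd₁
  have hmaps : ∀ w : ℂ, ‖w‖ < 1 → ‖(L : ℂ) * w‖ < |σ| := by
    intro w hw
    rw [norm_mul, Complex.norm_real, Real.norm_eq_abs, abs_of_pos hLpos]
    exact lt_trans (mul_lt_of_lt_one_right hLpos hw) hσL
  have hre : ∀ w : ℂ, ‖w‖ < 1 → |((L : ℂ) * w).re| ≤ L := by
    intro w hw
    have h1 := Complex.abs_re_le_norm ((L : ℂ) * w)
    rw [norm_mul, Complex.norm_real, Real.norm_eq_abs, abs_of_pos hLpos] at h1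
    exact h1.trans (le_of_lt (mul_lt_of_lt_one_right hLpos hw))
  refine ⟨fun w => g₁ ((L : ℂ) * w), ?_, ?_, ?_⟩
  · -- holomorphy on the unit disc
    refine hg₁.comp ((differentiable_id.const_mul (L : ℂ)).differentiableOn) fun w hw => ?_
    rw [mem_ball, dist_zero_right] at hw
    show (L : ℂ) * w ∈ ball (0 : ℂ) |σ|
    rw [mem_ball, dist_zero_right]
    exact hmaps w hw
  · -- the bound: the axis points lie in the annulus
    intro w hw
    rw [mem_ball, dist_zero_right] at hw
    have hLw : (L : ℂ) * w ∈ ball (0 : ℂ) |σ| := by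
      rw [mem_ball, dist_zero_right]; exact hmaps w hw
    refine (hbd₁ _ hLw).trans (hMnn _ ?_ ?_)
    · rw [norm_mk2_axis]
      have h2 : |σ| - |((L : ℂ) * w).re| ≤ |σ + ((L : ℂ) * w).re| := by
        have := abs_sub_abs_le_abs_sub σ (-((L : ℂ) * w).re)
        rwa [sub_neg_eq_add, abs_neg] at this
      have h3 := hre w hw
      rw [hyL]
      linarith
    · rw [norm_mk2_axis]
      have h3 : |σ| ≤ ‖q‖ := by rw [hσdef, hτ q]; exact abs_frameTime_le_norm hab q
      have h4 : ‖q‖ ≤ ‖y‖ + L := by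
        have := norm_add_le y ((d * L) • n')
        rw [norm_smul, hnorm', mul_one, Real.norm_eq_abs] at this
        rw [hq]; linarith
      have h5 := abs_add_le σ (((L : ℂ) * w).re)
      have h6 := hre w hw
      rw [hyL] at h4 ⊢
      linarith
  · -- the real trace
    intro s hs
    have hLs : |L * s| < |σ| := by
      rw [abs_mul, abs_of_pos hLpos]
      exact lt_of_le_of_lt (mul_le_of_le_one_right hLpos.le hs.le) hσL
    have h := hreal₁ (L * s) hLs
    push_cast at h
    dsimp only
    rw [h]
    congr 2
    refine ext2 ?_ ?_
    · rw [mk2_zero, hq0, lincomb_apply, hn0, hn'0]; ring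
    · rw [mk2_one, hq1, lincomb_apply, hn1, hn'1]; ring

/-- **The holomorphic chart from two good frames.**  Let `k ∈ InPlanarClass`, `y ≠ 0`, two unit frame normals `(a₁,b₁)`, `(a₂,b₂)` with
`|a₁a₂ + b₁b₂| ≤ 1/2`, frame times `τᵢ(q) = aᵢq₀ + bᵢq₁` with `|τᵢ(y)| ≥ ‖y‖/2`, complex time translation along both (`hF₁`, `hF₂`), and the
conclusion of the two-variable cross theorem with estimate at `ℓ = 1` for the radius `r` (`hcross`).  Then, with `L = ‖y‖/6`,
`t ↦ k(y + L t₀ n₁ + L t₁ n₂)` is on the cube `|tᵢ| < r` the trace of ONE function `G` holomorphic on the polydisc of radius `r`, bounded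
there by the maximum `|k(z₀)|` of `|k|` on the annulus `‖y‖/4 ≤ ‖·‖ ≤ 2‖y‖`. -/
theorem exists_frameChart {k : E2 → ℝ} (hk : InPlanarClass k) {y : E2} (hy : y ≠ 0)
    (τ₁ τ₂ : E2 → ℝ) (a₁ b₁ a₂ b₂ : ℝ) (hn₁ : a₁ ^ 2 + b₁ ^ 2 = 1) (hn₂ : a₂ ^ 2 + b₂ ^ 2 = 1)
    (hτ₁ : ∀ q, τ₁ q = a₁ * q 0 + b₁ * q 1) (hτ₂ : ∀ q, τ₂ q = a₂ * q 0 + b₂ * q 1)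
    (hinner : |a₁ * a₂ + b₁ * b₂| ≤ 1 / 2) (hy₁ : ‖y‖ / 2 ≤ |τ₁ y|) (hy₂ : ‖y‖ / 2 ≤ |τ₂ y|)
    (hF₁ : ∀ q : E2, τ₁ q ≠ 0 → ∃ g : ℂ → ℂ, DifferentiableOn ℂ g (ball (0 : ℂ) |τ₁ q|) ∧
        (∀ u : ℝ, |u| < |τ₁ q| → g u = k (mk2 (q 0 + u * a₁) (q 1 + u * b₁))) ∧
        ∀ w ∈ ball (0 : ℂ) |τ₁ q|, ‖g w‖ ≤ k (mk2 (τ₁ q + w.re) 0))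
    (hF₂ : ∀ q : E2, τ₂ q ≠ 0 → ∃ g : ℂ → ℂ, DifferentiableOn ℂ g (ball (0 : ℂ) |τ₂ q|) ∧
        (∀ u : ℝ, |u| < |τ₂ q| → g u = k (mk2 (q 0 + u * a₂) (q 1 + u * b₂))) ∧
        ∀ w ∈ ball (0 : ℂ) |τ₂ q|, ‖g w‖ ≤ k (mk2 (τ₂ q + w.re) 0))
    {r : ℝ}
    (hcross : ∀ (M : ℝ) (P : (Fin 2 → ℝ) → ℂ),
      (∀ x : Fin 2 → ℝ, (∀ i, |x i| < 1) → ‖P x‖ ≤ M) →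
      (∀ (i : Fin 2) (x : Fin 2 → ℝ), (∀ j, |x j| < 1) → ∃ g : ℂ → ℂ,
        DifferentiableOn ℂ g (ball (0 : ℂ) 1) ∧ (∀ w ∈ ball (0 : ℂ) 1, ‖g w‖ ≤ M) ∧
        ∀ t : ℝ, |t| < 1 → g t = P (Function.update x i t)) →
      ∃ G : (Fin 2 → ℂ) → ℂ,
        DifferentiableOn ℂ G {z : Fin 2 → ℂ | ∀ i, ‖z i‖ < r} ∧
        (∀ z : Fin 2 → ℂ, (∀ i, ‖z i‖ < r) → ‖G z‖ ≤ M) ∧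
        ∀ x : Fin 2 → ℝ, (∀ i, |x i| < r) → G (fun i => (x i : ℂ)) = P x) :
    ∃ z₀ : E2, ‖y‖ / 4 ≤ ‖z₀‖ ∧ ∃ G : (Fin 2 → ℂ) → ℂ,
      DifferentiableOn ℂ G {z : Fin 2 → ℂ | ∀ i, ‖z i‖ < r} ∧
      (∀ z : Fin 2 → ℂ, (∀ i, ‖z i‖ < r) → ‖G z‖ ≤ |k z₀|) ∧
      ∀ t : Fin 2 → ℝ, (∀ i, |t i| < r) →
        G (fun i => (t i : ℂ)) = ((k (y + (t 0 * (‖y‖ / 6)) • mk2 a₁ b₁ + (t 1 * (‖y‖ / 6)) • mk2 a₂ b₂) : ℝ) : ℂ) := by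
  have hcont : ContinuousOn k {y | y ≠ 0} := hk.1
  have hy_pos : 0 < ‖y‖ := norm_pos_iff.2 hy
  obtain ⟨L, hL⟩ : ∃ L : ℝ, L = ‖y‖ / 6 := ⟨_, rfl⟩
  have hLpos : 0 < L := by rw [hL]; positivity
  have hyL : ‖y‖ = 6 * L := by rw [hL]; ring
  obtain ⟨n₁, hn₁_def⟩ : ∃ n : E2, n = mk2 a₁ b₁ := ⟨_, rfl⟩
  obtain ⟨n₂, hn₂_def⟩ : ∃ n : E2, n = mk2 a₂ b₂ := ⟨_, rfl⟩
  have hn₁0 : n₁ 0 = a₁ := by rw [hn₁_def]; exact mk2_zero _ _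
  have hn₁1 : n₁ 1 = b₁ := by rw [hn₁_def]; exact mk2_one _ _
  have hn₂0 : n₂ 0 = a₂ := by rw [hn₂_def]; exact mk2_zero _ _
  have hn₂1 : n₂ 1 = b₂ := by rw [hn₂_def]; exact mk2_one _ _
  have hnorm₁ : ‖n₁‖ = 1 := by rw [hn₁_def]; exact norm_mk2_eq_one hn₁
  have hnorm₂ : ‖n₂‖ = 1 := by rw [hn₂_def]; exact norm_mk2_eq_one hn₂
  obtain ⟨A, hA⟩ : ∃ A : Set E2, A = {z | ‖y‖ / 4 ≤ ‖z‖} ∩ closedBall 0 (2 * ‖y‖) := ⟨_, rfl⟩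
  have hAc : IsCompact A := by
    rw [hA]
    exact (isCompact_closedBall (0 : E2) _).of_isClosed_subset
      ((isClosed_le continuous_const continuous_norm).inter isClosed_closedBall) Set.inter_subset_right
  have hA0 : A ⊆ {z | z ≠ 0} := by
    intro z hz hz0
    rw [hA] at hz
    have h1 : ‖y‖ / 4 ≤ ‖z‖ := hz.1
    rw [hz0, norm_zero] at h1
    linarith
  have hyA : y ∈ A := by
    rw [hA]
    exact ⟨by show ‖y‖ / 4 ≤ ‖y‖; linarith, by rw [mem_closedBall, dist_zero_right]; linarith⟩
  obtain ⟨z₀, hz₀A, hz₀⟩ := hAc.exists_isMaxOn ⟨y, hyA⟩ ((continuous_abs.comp_continuousOn (hcont.mono hA0)))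
  have hz₀' : ‖y‖ / 4 ≤ ‖z₀‖ := by rw [hA] at hz₀A; exact hz₀A.1
  have hMA : ∀ z : E2, ‖y‖ / 4 ≤ ‖z‖ → ‖z‖ ≤ 2 * ‖y‖ → |k z| ≤ |k z₀| := by
    intro z h1 h2
    exact hz₀ (by rw [hA]; exact ⟨h1, by rwa [mem_closedBall, dist_zero_right]⟩)
  have hMnn : ∀ z : E2, ‖y‖ / 4 ≤ ‖z‖ → ‖z‖ ≤ 2 * ‖y‖ → k z ≤ |k z₀| :=
    fun z h1 h2 => (le_abs_self _).trans (hMA z h1 h2)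
  have hpt_mem : ∀ c d : ℝ, |c| ≤ L → |d| ≤ L →
      ‖y‖ / 4 ≤ ‖y + c • n₁ + d • n₂‖ ∧ ‖y + c • n₁ + d • n₂‖ ≤ 2 * ‖y‖ := by
    intro c d hc hd
    have h1 : ‖c • n₁ + d • n₂‖ ≤ |c| + |d| := by
      refine (norm_add_le _ _).trans ?_
      rw [norm_smul, norm_smul, hnorm₁, hnorm₂, mul_one, mul_one, Real.norm_eq_abs, Real.norm_eq_abs]
    have h2 : ‖y + c • n₁ + d • n₂‖ ≤ ‖y‖ + ‖c • n₁ + d • n₂‖ := by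
      rw [add_assoc]; exact norm_add_le _ _
    have h3 : ‖y‖ ≤ ‖y + c • n₁ + d • n₂‖ + ‖c • n₁ + d • n₂‖ := by
      have e : y + c • n₁ + d • n₂ - (c • n₁ + d • n₂) = y := by abel
      have := norm_sub_le (y + c • n₁ + d • n₂) (c • n₁ + d • n₂)
      rwa [e] at this
    rw [hyL] at h2 h3 ⊢
    constructor <;> linarith
  obtain ⟨P, hP⟩ : ∃ P : (Fin 2 → ℝ) → ℂ,
      P = fun t => ((k (y + (t 0 * L) • n₁ + (t 1 * L) • n₂) : ℝ) : ℂ) := ⟨_, rfl⟩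
  have hPt : ∀ t : Fin 2 → ℝ, P t = ((k (y + (t 0 * L) • n₁ + (t 1 * L) • n₂) : ℝ) : ℂ) := fun t => by rw [hP]
  have htL : ∀ c : ℝ, |c| < 1 → |c * L| ≤ L := fun c hc => by
    rw [abs_mul, abs_of_pos hLpos]
    exact le_of_lt (mul_lt_of_lt_one_left hLpos hc)
  have hPbd : ∀ t : Fin 2 → ℝ, (∀ i, |t i| < 1) → ‖P t‖ ≤ |k z₀| := by
    intro t ht
    rw [hPt, Complex.norm_real, Real.norm_eq_abs]
    obtain ⟨hl, hu⟩ := hpt_mem _ _ (htL _ (ht 0)) (htL _ (ht 1))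
    exact hMA _ hl hu
  have hslices : ∀ (i : Fin 2) (t : Fin 2 → ℝ), (∀ j, |t j| < 1) → ∃ g : ℂ → ℂ,
      DifferentiableOn ℂ g (ball (0 : ℂ) 1) ∧ (∀ w ∈ ball (0 : ℂ) 1, ‖g w‖ ≤ |k z₀|) ∧
      ∀ s : ℝ, |s| < 1 → g s = P (Function.update t i s) := by
    intro i t ht
    fin_cases i
    · obtain ⟨g, hg, hgM, hgs⟩ := frame_slice hL hLpos hMnn τ₁ a₁ b₁ n₁ n₂ a₂ b₂ hn₁0 hn₁1 hnorm₂ hn₂0 hn₂1 hn₁ hτ₁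
        hinner hy₁ hF₁ (t 1) (ht 1)
      refine ⟨g, hg, hgM, fun s hs => ?_⟩
      rw [hgs s hs, hPt]
      simp
    · have hinner' : |a₂ * a₁ + b₂ * b₁| ≤ 1 / 2 := by rw [mul_comm a₂, mul_comm b₂]; exact hinner
      obtain ⟨g, hg, hgM, hgs⟩ := frame_slice hL hLpos hMnn τ₂ a₂ b₂ n₂ n₁ a₁ b₁ hn₂0 hn₂1 hnorm₁ hn₁0 hn₁1 hn₂ hτ₂
        hinner' hy₂ hF₂ (t 0) (ht 0)
      refine ⟨g, hg, hgM, fun s hs => ?_⟩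
      have e : y + (s * L) • n₂ + (t 0 * L) • n₁ = y + (t 0 * L) • n₁ + (s * L) • n₂ := by abel
      rw [hgs s hs, hPt, e]
      simp
  obtain ⟨G, hGd, hGM, hGr⟩ := hcross (|k z₀|) P hPbd hslices
  refine ⟨z₀, hz₀', G, hGd, hGM, fun t ht => ?_⟩
  rw [hGr t ht, hPt, hL, hn₁_def, hn₂_def]

end Summit.QuantumFields.YangMills.Theorems.F4SubCurvatureDoorPlanarFrames

end
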